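import Mathlib.Data.Real.Basic
import Mathlib.Tactic.Linarith
import Mathlib.Tactic.Ring
import Mathlib.Tactic.Positivity
import HarnessLib

/-!
# One-target sides of two-separations (root outside), I: the real core

Support file for the Sahi programme (`--supports stmt-CriticalPhenomena-4575`, prover prim-sahi-p2 gen 24).  No definitions, no named
facts, no sorries; standard axioms.  Memo `run/shared/lean/prim/prim-sahi/FROM-prim-sahi-p2-gen24-ONE-TARGET-SIDE.md` §1.

**Setting (THEOREM G′).**  A two-separator `{u, v}` NOT containing the root: the root side `R ∋ s` is joined to the rest only through
`u, v ∉ R`; one target `a` lies strictly outside `R ∪ {u, v}`, the targets `b, c` lie in `R ∪ {u, v}`.  Near numbers (pairs not meeting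
`R`): `ζ = P(u ~ v)`, `v_u = P(a ~ u, a ≁ v)`, `v_v = P(a ~ v, a ≁ u)`, `v_Z = P(a ~ u ~ v)`; Harris for `{a ~ {u,v}}` and `{u ~ v}` reads
`ζ (v_u + v_v + v_Z) ≤ v_Z`.  Far numbers (pairs meeting `R`): `x_u = P(X_u)`, `X_u = {s ~ u}`, `x_v`, `ρ = P(X_u ∪ X_v)`; for the far targets the
plain events `B_t = {s ~ t}` and the merged events `B¹_t = B_t ∪ (X_u ∩ {v ~ t}) ∪ (X_v ∩ {u ~ t}) ⊇ B_t` (the root reaches `t` once `u ≡ v`), with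
`β = P(B_b)`, `γ = P(B_c)`, `m = P(B_b ∩ B_c)`, `β₁, γ₁, m₁` the same for `B¹`, `p_{ub} = P(X_u ∩ B_b)`, …, `p_{ubc} = P(X_u ∩ B_b ∩ B_c)`, the same
with `v`, and `r_b = P((X_u ∪ X_v) ∩ B¹_b)`, `r_c`, `r_{bc}`.  Then (`…OneTargetSideMoments`)
`E₃({s↔a},{s↔b},{s↔c}) = v_u Φ_u + v_v Φ_v + v_Z Φ_Z` and `E₃({s↔u},{s↔b},{s↔c}) = (1 − ζ) Φ_u + ζ Φ_Z`, where with
`P_b = (1−ζ)β + ζβ₁`, `P_c = (1−ζ)γ + ζγ₁`, `P_{bc} = (1−ζ)m + ζm₁`: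
`Φ_u = 2p_{ubc} − p_{ub}P_c − p_{uc}P_b − P_{bc}x_u + x_uP_bP_c`, `Φ_v` likewise, `Φ_Z = 2r_{bc} − r_bP_c − r_cP_b − P_{bc}ρ + ρP_bP_c`.

* `oneTargetSide_phiZ_nonneg` — `Φ_Z = E₃¹ + (1−ζ)[(γ₁−γ)(r_b − ρβ₁) + (β₁−β)(r_c − ργ₁) + ρ(m₁−m)] + (1−ζ)²ρ(β₁−β)(γ₁−γ) ≥ 0`, where
  `E₃¹ = 2r_{bc} − r_bγ₁ − r_cβ₁ − m₁ρ + ρβ₁γ₁` is the star of the far side with `u ≡ v` (hypothesis) and the brackets are Harris facts;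
* `oneTargetSide_threeRay_nonneg` — the THREE-RAY IDENTITY `(1−ζ)·E₃ = h·Φ_Z + v_u·[(1−ζ)Φ_u + ζΦ_Z] + v_v·[(1−ζ)Φ_v + ζΦ_Z]` with
  `h = v_Z − ζ(v_u+v_v+v_Z) ≥ 0`, whence `0 ≤ E₃` from the three star hypotheses (for `ζ = 1` the Harris constraint forces `v_u = v_v = 0`).
-/

namespace Summit.CriticalPhenomena.PercolationContinuityZ3.Theorems

namespace IncStarOneTargetSide

/-- **`Φ_Z ≥ 0`.**  With the notation of the module docstring: if `0 ≤ E₃¹ = 2r_{bc} − r_bγ₁ − r_cβ₁ − m₁ρ + ρβ₁γ₁` (star of the far side with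
`u ≡ v`), `ρβ₁ ≤ r_b`, `ργ₁ ≤ r_c` (Harris), `β ≤ β₁`, `γ ≤ γ₁`, `m ≤ m₁`, `0 ≤ ρ` and `ζ ≤ 1`, then
`0 ≤ Φ_Z = 2r_{bc} − r_bP_c − r_cP_b − P_{bc}ρ + ρP_bP_c` (`P_b = (1−ζ)β + ζβ₁`, etc.). [this work] -/
theorem oneTargetSide_phiZ_nonneg {ζ ρ β γ m β₁ γ₁ m₁ rb rc rbc : ℝ}
    (hζ1 : ζ ≤ 1) (hρ : 0 ≤ ρ) (hβ : β ≤ β₁) (hγ : γ ≤ γ₁) (hm : m ≤ m₁)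
    (hrb : ρ * β₁ ≤ rb) (hrc : ρ * γ₁ ≤ rc)
    (hstar1 : 0 ≤ 2 * rbc - rb * γ₁ - rc * β₁ - m₁ * ρ + ρ * β₁ * γ₁) :
    0 ≤ 2 * rbc - rb * ((1 - ζ) * γ + ζ * γ₁) - rc * ((1 - ζ) * β + ζ * β₁) - ((1 - ζ) * m + ζ * m₁) * ρ
      + ρ * ((1 - ζ) * β + ζ * β₁) * ((1 - ζ) * γ + ζ * γ₁) := by
  have hid : 2 * rbc - rb * ((1 - ζ) * γ + ζ * γ₁) - rc * ((1 - ζ) * β + ζ * β₁) - ((1 - ζ) * m + ζ * m₁) * ρ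
      + ρ * ((1 - ζ) * β + ζ * β₁) * ((1 - ζ) * γ + ζ * γ₁)
      = (2 * rbc - rb * γ₁ - rc * β₁ - m₁ * ρ + ρ * β₁ * γ₁)
        + (1 - ζ) * ((γ₁ - γ) * (rb - ρ * β₁) + (β₁ - β) * (rc - ρ * γ₁) + ρ * (m₁ - m))
        + (1 - ζ) ^ 2 * (ρ * ((β₁ - β) * (γ₁ - γ))) := by ring
  rw [hid]
  have h1 : 0 ≤ 1 - ζ := sub_nonneg.2 hζ1
  have t1 : 0 ≤ (γ₁ - γ) * (rb - ρ * β₁) := mul_nonneg (sub_nonneg.2 hγ) (sub_nonneg.2 hrb)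
  have t2 : 0 ≤ (β₁ - β) * (rc - ρ * γ₁) := mul_nonneg (sub_nonneg.2 hβ) (sub_nonneg.2 hrc)
  have t3 : 0 ≤ ρ * (m₁ - m) := mul_nonneg hρ (sub_nonneg.2 hm)
  have t4 : 0 ≤ ρ * ((β₁ - β) * (γ₁ - γ)) := mul_nonneg hρ (mul_nonneg (sub_nonneg.2 hβ) (sub_nonneg.2 hγ))
  have s1 : 0 ≤ (1 - ζ) * ((γ₁ - γ) * (rb - ρ * β₁) + (β₁ - β) * (rc - ρ * γ₁) + ρ * (m₁ - m)) :=
    mul_nonneg h1 (by linarith)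
  have s2 : 0 ≤ (1 - ζ) ^ 2 * (ρ * ((β₁ - β) * (γ₁ - γ))) := mul_nonneg (pow_nonneg h1 2) t4
  linarith

/-- **The three-ray argument (THEOREM G′, real core).**  `(1−ζ)·(v_uΦ_u + v_vΦ_v + v_ZΦ_Z) = h·Φ_Z + v_u·[(1−ζ)Φ_u + ζΦ_Z] + v_v·[(1−ζ)Φ_v + ζΦ_Z]`
with `h = v_Z − ζ(v_u + v_v + v_Z)`; so if `h, v_u, v_v, v_Z ≥ 0`, `ζ ≤ 1`, `Φ_Z ≥ 0` and the two mixed stars are `≥ 0`, then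
`0 ≤ v_uΦ_u + v_vΦ_v + v_ZΦ_Z` (for `ζ = 1` the constraint `h ≥ 0` forces `v_u = v_v = 0`). [this work] -/
theorem oneTargetSide_threeRay_nonneg {ζ vu vv vZ Φu Φv ΦZ : ℝ}
    (hζ1 : ζ ≤ 1) (hvu : 0 ≤ vu) (hvv : 0 ≤ vv) (hvZ : 0 ≤ vZ)
    (hh : ζ * (vu + vv + vZ) ≤ vZ) (hΦZ : 0 ≤ ΦZ)
    (hU : 0 ≤ (1 - ζ) * Φu + ζ * ΦZ) (hV : 0 ≤ (1 - ζ) * Φv + ζ * ΦZ) :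
    0 ≤ vu * Φu + vv * Φv + vZ * ΦZ := by
  have hid : (1 - ζ) * (vu * Φu + vv * Φv + vZ * ΦZ)
      = (vZ - ζ * (vu + vv + vZ)) * ΦZ + vu * ((1 - ζ) * Φu + ζ * ΦZ) + vv * ((1 - ζ) * Φv + ζ * ΦZ) := by ring
  have hrhs : 0 ≤ (1 - ζ) * (vu * Φu + vv * Φv + vZ * ΦZ) := by
    rw [hid]
    have t1 : 0 ≤ (vZ - ζ * (vu + vv + vZ)) * ΦZ := mul_nonneg (sub_nonneg.2 hh) hΦZ
    have t2 : 0 ≤ vu * ((1 - ζ) * Φu + ζ * ΦZ) := mul_nonneg hvu hU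
    have t3 : 0 ≤ vv * ((1 - ζ) * Φv + ζ * ΦZ) := mul_nonneg hvv hV
    linarith
  rcases lt_or_eq_of_le hζ1 with hlt | heq
  · have hpos : 0 < 1 - ζ := sub_pos.2 hlt
    by_contra hneg
    push Not at hneg
    have : (1 - ζ) * (vu * Φu + vv * Φv + vZ * ΦZ) < 0 := mul_neg_of_pos_of_neg hpos hneg
    linarith
  · subst heq
    have hvu0 : vu = 0 := by linarith
    have hvv0 : vv = 0 := by linarith
    subst hvu0 hvv0
    simpa using mul_nonneg hvZ hΦZ

end IncStarOneTargetSide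

end Summit.CriticalPhenomena.PercolationContinuityZ3.Theorems
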